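import Mathlib
import Summits.Ventures.PercRepro.TriangleCapEqualityLocusTriangleFree

/-!
# PercRepro — THE TRIANGLE-FREE CHERRY TABLE BELOW THE DENSE CORNER: the `r`-term is the bound on the row
`a = 2` as well (p3, gen 42; part 179)

For `K₄⁻`-free graphs the cherry table has two regimes — the star plus a matching below `m = 2k − 3`
(§10aq) and the closed form `Σ_v d(v)² ≤ m k − r (k − 1 − r)` in the dense corner (§10bo / part 167).  On the
TRIANGLE-FREE class the star plus a matching is not available (its extra edges close triangles), and the
closed form holds on EVERY cell: this module is the row `a = 2` (`k ≤ m ≤ 2k − 4`, `r = 2(k−2) − m`),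
`cliqueFree_sparse_stability`: a triangle-free graph on `k` vertices with `2(k−2) − r` edges, `4 + r ≤ k`,
has `Σ_v d(v)² + r (k − 1 − r) ≤ m k` — by the degree argument of part 167 with the only two ingredients the
`K₄⁻`-free row lemmas lacked at `a = 2`: the cap `d(v) ≤ k − 2` (a vertex adjacent to everything leaves no
room for a `k`-th edge: `deg_add_two_le_of_cliqueFree`) and Mantel's degree-sum inequality `Σ d² ≤ m k` on
EVERY vertex count (`sum_deg_sq_le_of_cliqueFree`: adjacent vertices have disjoint neighbourhoods).  Every
degree `≥ 2` gives `Σ d² + r k ≤ m k` (`band_stability_of_min_degree_strict`); a vertex of degree `≤ 1` is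
deleted within the row (`band_of_low_degree`, induction on `k`) or across it onto the envelope
(`band_of_low_degree_cross_env`, the cross-row arithmetic of part 167 with the envelope supplied).
Axioms: standard.
-/

namespace PercRepro

namespace TriangleCap

namespace C047

open Finset

universe u

variable {V : Type*} [Fintype V] [DecidableEq V]

/-- **ADJACENT VERTICES OF A TRIANGLE-FREE GRAPH HAVE DISJOINT NEIGHBOURHOODS:** `d(x) + d(y) ≤ k`. -/
theorem deg_add_deg_le_of_cliqueFree (D : SimpleGraph V) [DecidableRel D.Adj] (hfree : D.CliqueFree 3)
    {x y : V} (hxy : D.Adj x y) : deg D x + deg D y ≤ Fintype.card V := by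
  unfold deg
  rw [← card_union_of_disjoint]
  · exact card_le_univ _
  · rw [disjoint_filter]
    intro w _ hxw hyw
    exact hfree {x, y, w} (SimpleGraph.is3Clique_triple_iff.mpr ⟨hxy, hxw, hyw⟩)

omit [DecidableEq V] in
/-- `d(x)² = Σ_y [x ∼ y] d(x)`. -/
theorem deg_mul_deg_eq_sum (D : SimpleGraph V) [DecidableRel D.Adj] (x : V) :
    deg D x * deg D x = ∑ y, (if D.Adj x y then deg D x else 0) := by
  nth_rewrite 2 [deg_eq_sum_boole D x]
  rw [mul_sum]
  apply sum_congr rfl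
  intro y _
  split_ifs <;> simp

/-- **MANTEL'S DEGREE-SUM INEQUALITY ON EVERY VERTEX COUNT:** triangle-free ⇒ `Σ_v d(v)² ≤ m k`. -/
theorem sum_deg_sq_le_of_cliqueFree (D : SimpleGraph V) [DecidableRel D.Adj] (hfree : D.CliqueFree 3) :
    ∑ v, deg D v * deg D v ≤ D.edgeFinset.card * Fintype.card V := by
  have hA : ∑ v, deg D v * deg D v = ∑ x, ∑ y, (if D.Adj x y then deg D x else 0) :=
    sum_congr rfl (fun x _ => deg_mul_deg_eq_sum D x)
  have hB : ∑ v, deg D v * deg D v = ∑ x, ∑ y, (if D.Adj x y then deg D y else 0) := by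
    rw [hA, sum_comm]
    refine sum_congr rfl (fun y _ => sum_congr rfl (fun x _ => ?_))
    simp only [D.adj_comm x y]
  have h3 : ∑ v, deg D v * deg D v + ∑ v, deg D v * deg D v =
      ∑ x, ∑ y, (if D.Adj x y then deg D x + deg D y else 0) := by
    calc ∑ v, deg D v * deg D v + ∑ v, deg D v * deg D v
        = (∑ x, ∑ y, (if D.Adj x y then deg D x else 0)) +
            ∑ x, ∑ y, (if D.Adj x y then deg D y else 0) := by rw [← hA, ← hB]
      _ = ∑ x, ∑ y, (if D.Adj x y then deg D x + deg D y else 0) := by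
        rw [← sum_add_distrib]
        refine sum_congr rfl (fun x _ => ?_)
        rw [← sum_add_distrib]
        refine sum_congr rfl (fun y _ => ?_)
        split_ifs <;> simp
  have h4 : ∑ x, ∑ y, (if D.Adj x y then deg D x + deg D y else 0) ≤
      ∑ x, ∑ y, (if D.Adj x y then Fintype.card V else 0) := by
    refine sum_le_sum (fun x _ => sum_le_sum (fun y _ => ?_))
    split_ifs with h
    · exact deg_add_deg_le_of_cliqueFree D hfree h
    · exact le_refl 0
  have h5 : ∑ x, ∑ y, (if D.Adj x y then Fintype.card V else 0) = Fintype.card V * ∑ x, deg D x := by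
    rw [mul_sum]
    refine sum_congr rfl (fun x _ => ?_)
    rw [deg_eq_sum_boole, mul_sum]
    refine sum_congr rfl (fun y _ => ?_)
    split_ifs <;> simp
  have h6 := sum_deg_eq D
  rw [h5, h6] at h4
  rw [← h3] at h4
  nlinarith [h4]

/-- **THE CAP ON THE ROW `a = 2`:** a triangle-free graph with at least `k` edges has every degree `≤ k − 2`
(a vertex adjacent to all the others makes every edge contain it, `m = k − 1`). -/
theorem deg_add_two_le_of_cliqueFree (D : SimpleGraph V) [DecidableRel D.Adj] (hfree : D.CliqueFree 3)
    (hm : Fintype.card V ≤ D.edgeFinset.card) (x : V) : deg D x + 2 ≤ Fintype.card V := by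
  by_contra hcon
  push Not at hcon
  -- `x` is adjacent to every other vertex
  have hsub : univ.filter (fun w => D.Adj x w) ⊆ univ.erase x := by
    intro w hw
    rw [mem_filter] at hw
    exact mem_erase.mpr ⟨(D.ne_of_adj hw.2).symm, mem_univ w⟩
  have hcard : (univ.erase x).card = Fintype.card V - 1 := by
    rw [card_erase_of_mem (mem_univ x), card_univ]
  have hdeg : deg D x = Fintype.card V - 1 := by
    unfold deg
    have := card_le_card hsub
    unfold deg at hcon
    omega
  have hall : ∀ w, w ≠ x → D.Adj x w := by
    intro w hw
    have heq : univ.filter (fun w => D.Adj x w) = univ.erase x :=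
      eq_of_subset_of_card_le hsub (by rw [hcard]; unfold deg at hdeg; omega)
    have : w ∈ univ.filter (fun w => D.Adj x w) := by
      rw [heq]
      exact mem_erase.mpr ⟨hw, mem_univ w⟩
    exact (mem_filter.mp this).2
  -- every other vertex has degree exactly `1`
  have hone : ∀ w, w ≠ x → deg D w = 1 := by
    intro w hw
    unfold deg
    have : univ.filter (fun u => D.Adj w u) = {x} := by
      ext u
      simp only [mem_filter, mem_univ, true_and, mem_singleton]
      constructor
      · intro hwu
        by_contra hux
        exact hfree {x, w, u}
          (SimpleGraph.is3Clique_triple_iff.mpr ⟨hall w hw, hall u hux, hwu⟩)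
      · rintro rfl
        exact D.adj_symm (hall w hw)
    rw [this, card_singleton]
  have hsum := sum_deg_eq D
  rw [← add_sum_erase univ _ (mem_univ x), hdeg] at hsum
  rw [sum_congr rfl (fun w hw => hone w (mem_erase.mp hw).1), sum_const, hcard, smul_eq_mul] at hsum
  have hk : 1 ≤ Fintype.card V := Fintype.card_pos_iff.mpr ⟨x⟩
  omega

/-- **A VERTEX OF LOW DEGREE, ACROSS THE ROW, WITH THE ENVELOPE SUPPLIED:** `r + d(z) ≤ a − 1` with the cap
`d ≤ k − a` and `Σ d² ≤ m' (k − 1)` on `D − z` ⇒ the cell `r` of the row `a` at `k` (part 167's cross-row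
arithmetic, the envelope a hypothesis instead of the `K₄⁻`-free envelope at `k − 1 ≥ 6`). -/
theorem band_of_low_degree_cross_env (D : SimpleGraph V) [DecidableRel D.Adj] (a r : ℕ)
    (hcap : ∀ v, deg D v + a ≤ Fintype.card V) {z : V} (hrd : r + deg D z + 1 ≤ a)
    (hk : r + 2 * a ≤ Fintype.card V) (hm : D.edgeFinset.card + a * a + r = a * Fintype.card V)
    (henv : ∑ v, deg (del D z) v * deg (del D z) v ≤ (del D z).edgeFinset.card * Fintype.card {v : V // v ≠ z}) :
    ∑ v, deg D v * deg D v + r * (Fintype.card V - 1 - r) ≤ D.edgeFinset.card * Fintype.card V := by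
  have hcard := card_del z
  have hedges := card_edges_del D z
  have hsq := sum_deg_sq_del D z
  have hT := sum_del_nbhd_le D z (Fintype.card V - a - 1) (fun v => by have := hcap v; omega)
  obtain ⟨k', hk'⟩ : ∃ k', Fintype.card {v : V // v ≠ z} = k' := ⟨_, rfl⟩
  obtain ⟨m', hm'⟩ : ∃ m', (del D z).edgeFinset.card = m' := ⟨_, rfl⟩
  obtain ⟨d, hdz⟩ : ∃ d, deg D z = d := ⟨_, rfl⟩
  obtain ⟨T, hTT⟩ : ∃ T, ∑ a : {v : V // v ≠ z}, (if D.Adj a.1 z then deg (del D z) a else 0) = T := ⟨_, rfl⟩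
  obtain ⟨S, hS⟩ : ∃ S, ∑ v, deg (del D z) v * deg (del D z) v = S := ⟨_, rfl⟩
  rw [hk'] at hcard henv
  rw [hm'] at hedges henv
  rw [hdz] at hedges hsq hT hrd
  rw [hTT] at hsq hT
  rw [hS] at hsq henv
  have hkV : Fintype.card V = k' + 1 := by omega
  have hmD : D.edgeFinset.card = m' + d := by omega
  rw [hkV, hmD]
  rw [hkV] at hm hT hk
  rw [hmD] at hm
  rw [hsq]
  obtain ⟨t, rfl⟩ : ∃ t, a = r + d + 1 + t := ⟨a - (r + d + 1), by omega⟩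
  obtain ⟨j, rfl⟩ : ∃ j, k' = 3 * r + 2 * d + 1 + 2 * t + j := ⟨k' - (3 * r + 2 * d + 1 + 2 * t), by omega⟩
  have e3 : 3 * r + 2 * d + 1 + 2 * t + j + 1 - 1 - r = 2 * r + 2 * d + 1 + 2 * t + j := by omega
  have e4 : 3 * r + 2 * d + 1 + 2 * t + j + 1 - (r + d + 1 + t) - 1 = 2 * r + d + t + j := by omega
  rw [e3]
  rw [e4] at hT
  have := band_low_degree_cross_arith r d t j S T m' henv hT hm
  linarith

/-- **THE ROW `a = 2` OF THE TRIANGLE-FREE CHERRY TABLE, BY INDUCTION ON `k`:** on `n + 4` vertices, triangle-free,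
`4 + r ≤ k`, `m + 4 + r = 2k` ⇒ `Σ_v d(v)² + r (k − 1 − r) ≤ m k`. -/
theorem cliqueFree_sparse_stability_aux (n : ℕ) :
    ∀ (W : Type u) [Fintype W] [DecidableEq W] (D : SimpleGraph W) [DecidableRel D.Adj],
      Fintype.card W = n + 4 → D.CliqueFree 3 →
      ∀ r, 4 + r ≤ Fintype.card W → D.edgeFinset.card + 2 * 2 + r = 2 * Fintype.card W →
      ∑ v, deg D v * deg D v + r * (Fintype.card W - 1 - r) ≤ D.edgeFinset.card * Fintype.card W := by
  induction n with
  | zero =>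
    intro W _ _ D _ hcard hfree r hk hm
    have hcap : ∀ v, deg D v + 2 ≤ Fintype.card W := deg_add_two_le_of_cliqueFree D hfree (by omega)
    by_cases hdeg : ∀ z, 2 ≤ deg D z
    · have := band_stability_of_min_degree_strict D 2 r hcap hdeg (by omega) hm
      have h2 : r * (Fintype.card W - 1 - r) ≤ r * Fintype.card W := Nat.mul_le_mul_left r (by omega)
      omega
    · push Not at hdeg
      obtain ⟨z, hz⟩ := hdeg
      -- `k = 4`, `r = 0`: a vertex of degree `≤ 1` is deleted across the row onto the envelope
      have hfree' := cliqueFree_del D hfree z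
      exact band_of_low_degree_cross_env D 2 r hcap (z := z) (by omega) (by omega) hm
        (sum_deg_sq_le_of_cliqueFree (del D z) hfree')
  | succ n ih =>
    intro W _ _ D _ hcard hfree r hk hm
    have hcap : ∀ v, deg D v + 2 ≤ Fintype.card W := deg_add_two_le_of_cliqueFree D hfree (by omega)
    by_cases hdeg : ∀ z, 2 ≤ deg D z
    · have := band_stability_of_min_degree_strict D 2 r hcap hdeg (by omega) hm
      have h2 : r * (Fintype.card W - 1 - r) ≤ r * Fintype.card W := Nat.mul_le_mul_left r (by omega)
      omega
    · push Not at hdeg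
      obtain ⟨z, hz⟩ := hdeg
      have hfree' := cliqueFree_del D hfree z
      rcases Nat.lt_or_ge (r + deg D z) 2 with hcross | hwithin
      · exact band_of_low_degree_cross_env D 2 r hcap (z := z) (by omega) (by omega) hm
          (sum_deg_sq_le_of_cliqueFree (del D z) hfree')
      · have hcard' := card_del z
        have hedges' := card_edges_del D z
        have hm' : (del D z).edgeFinset.card + 2 * 2 + (r + deg D z - 2) = 2 * Fintype.card {v : W // v ≠ z} := by
          omega
        have hrow := ih {v : W // v ≠ z} (del D z) (by omega) hfree' (r + deg D z - 2) (by omega) hm'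
        exact band_of_low_degree D 2 r hcap (z := z) (by omega) hwithin (by omega) hm hrow

/-- **THE ROW `a = 2` OF THE TRIANGLE-FREE CHERRY TABLE:** a triangle-free graph on `k` vertices with
`m = 2(k − 2) − r` edges, `4 + r ≤ k` (i.e. `k ≤ m ≤ 2k − 4`), has `Σ_v d(v)² + r (k − 1 − r) ≤ m k`. -/
theorem cliqueFree_sparse_stability (D : SimpleGraph V) [DecidableRel D.Adj] (hfree : D.CliqueFree 3) (r : ℕ)
    (hk : 4 + r ≤ Fintype.card V) (hm : D.edgeFinset.card + 2 * 2 + r = 2 * Fintype.card V) :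
    ∑ v, deg D v * deg D v + r * (Fintype.card V - 1 - r) ≤ D.edgeFinset.card * Fintype.card V :=
  cliqueFree_sparse_stability_aux (Fintype.card V - 4) V D (by omega) hfree r hk hm

end C047

end TriangleCap

end PercRepro
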